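import Literature.Probability.RandomPlanarGeometry.SAWCountZdSymbolSecondCoefficient
import HarnessLib

/-!
# The third coefficient of the symbol polynomial: `[X^{2j−5}] R_j` from six corner shape sums (all `j ≥ 3`)

Topic `Literature/Probability/RandomPlanarGeometry` (the «SYMBOL POLYNOMIALITY» programme for `c_n(ℤ^d)`, THIRD layer: `SAWCountZdSymbolSecondCoefficient.lean`
(a-p1 g26: `secondShapeSumTop/Below`, the three-corner formula for `[X^{2j−4}] R_j`, the term lemmas `coeff_symbolPoly_term_eq_zero_of_breaks_lt`,
`symbolPoly_term_eq_zero_of_card_eq_zero`), `SAWCountZdSymbolLeadingCoefficient.lean` (a-p1 g25: `topShapeSum`, `coeff_symbolPoly_top`),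
`SAWCountZdRepeatSetShapes.lean` / `SAWCountZdSymbolPolynomiality.lean` (a-p1 g22: `symbolPoly`, `shapeClass`, `breaks`, `AdjValid`)).

PRINTED CONTEXT (locators only; nothing below is in print). Madras–Slade (1993) §1.1 eq. (1.1.8) p. 5, Definition 1.2.4, §1.2 p. 10; Clisby–Liang–Slade (2007)
§3.3 eqs. (29)/(31); Stanley EC1 §1.3 Prop. 1.3.7 eq. (1.28) (elementary symmetric functions of an arithmetic progression: the coefficients of a shifted
falling factorial).

THE RESULT. `R_j = symbolPoly j = Σ_{u ≤ 2j} Σ_{A valid} #𝒢_j(u,A)·2^{−u}/b!·(X)_b ∘ (X + 1 − u)` (`b = breaks A`; a non-empty class needs `b + 3 ≤ u ≤ 2j`). Six corners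
reach `X^{2j−5}` (`j ≥ 3`): `(2j, 2j−3)` through the THIRD coefficient `e₂` of the shifted falling factorial, `(2j, 2j−4)` and `(2j−1, 2j−4)` through the second,
and the three THIRD-LAYER corners `(2j, 2j−5)`, `(2j−1, 2j−5)`, `(2j−2, 2j−5)` through the first. ★ `coeff_descPochhammer_comp_X_add_C_pair` — the second and third
coefficients of `(X)_{n+2} ∘ (X + c)`: `(n+2)c − (n+2)(n+1)/2` and `(n+2)(n+1)/2·(c² − (n+1)c) + (n+2)(n+1)n(3n+5)/24`; ★ the three THIRD-LAYER SHAPE SUMS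
`thirdShapeSumTop j = T'_j = M_j(2j, 2j−5)`, `thirdShapeSumMid j = X'_j = M_j(2j−1, 2j−5)`, `thirdShapeSumLow j = W'_j = M_j(2j−2, 2j−5)` (defs; the lane's census
values `5040, 2256, 192` (`j = 4`), `355200, 137920, 10560` (`j = 5`), `24380160, 8359680, 582400` (`j = 6`); closed forms for all `j` in
FINDING-ZD-SYMBOL-POLYNOMIALITY §16 (i), sealed as blind predictions «Am. BR» at `j = 7, 8`); ★★★ `coeff_symbolPoly_two_mul_sub_five` — for every `j ≥ 3`,
**`[X^{2j−5}] R_j = S_j·2^{−2j}/(2j−3)!·e₂(j) + U'_j·2^{−2j}/(2j−4)!·s_U(j) + V'_j·2^{−(2j−1)}/(2j−4)!·s_V(j) + T'_j·2^{−2j}/(2j−5)! + X'_j·2^{−(2j−1)}/(2j−5)! +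
W'_j·2^{−(2j−2)}/(2j−5)!`** with `e₂(j) = (2j−3)(2j−4)/2·((1−2j)² − (2j−4)(1−2j)) + (2j−3)(2j−4)(2j−5)(6j−10)/24`, `s_U(j) = (2j−4)(1−2j) − (2j−4)(2j−5)/2`,
`s_V(j) = (2j−4)(2−2j) − (2j−4)(2j−5)/2`. With the closed forms of §15–§16 this is the THIRD-LAYER LAW `[X^{2j−5}] R_j = (8j⁴ − 13j³ − 8j² + 28j − 48)/(9·2^j·(j−2)!)`
(`ThirdLayerCoeff j` of `SAWCountZdSymbolThirdCancellation`, the hypothesis of the THIRD CANCELLATION `[X^{2j−5}] B_j = 0`, `j ≥ 5`).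

THIS FILE (lane «pcv-sawmu», a-p1 g26; all PROVED, standard axioms): `coeff_descPochhammer_comp_X_add_C_pair` (private), `thirdShapeSumTop`, `thirdShapeSumMid`, `thirdShapeSumLow`,
`coeff_symbolPoly_term_sub_five_eq_zero`, `coeff_symbolPoly_term_top_sub_five`, `coeff_symbolPoly_term_second_sub_five`, `coeff_symbolPoly_term_breaks`,
★★★ `coeff_symbolPoly_two_mul_sub_five`.
[cite: MadrasSlade1993, §1.1 eq. (1.1.8) p. 5; Definition 1.2.4; §1.2 (p. 10)] [cite: ClisbyLiangSlade2007, §3.3 eqs. (29)/(31)] [cite: Stanley2012EC1, §1.3 Prop. 1.3.7 eq. (1.28)]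

Provenance: lane «pcv-sawmu», a-p1 g26 (2026-08-28).
-/

noncomputable section

open Finset
open scoped BigOperators
open Literature.Probability.LatticeModels
open Literature.Probability.RandomPlanarGeometry.SAW
open Literature.Probability.Percolation

namespace Literature.Probability.RandomPlanarGeometry.SAW.Zd

namespace WordTypes

variable {u : ℕ}

/-! ### The second and third coefficients of a shifted falling factorial -/

open Polynomial in
/-- `[X^{n+1}]` and `[X^n]` of `(X)_{n+2} ∘ (X + c) = Π_{i ≤ n+1} (X + c − i)`: `e₁ = (n+2)c − (n+2)(n+1)/2` and
`e₂ = (n+2)(n+1)/2·(c² − (n+1)c) + (n+2)(n+1)n(3n+5)/24`. [cite: Stanley2012EC1, §1.3 Prop. 1.3.7 eq. (1.28); lane lemma] -/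
private theorem coeff_descPochhammer_comp_X_add_C_pair (n : ℕ) (c : ℚ) :
    ((descPochhammer ℚ (n + 2)).comp (Polynomial.X + Polynomial.C c)).coeff (n + 1) = ((n : ℚ) + 2) * c - ((n : ℚ) + 2) * ((n : ℚ) + 1) / 2 ∧
    ((descPochhammer ℚ (n + 2)).comp (Polynomial.X + Polynomial.C c)).coeff n =
      ((n : ℚ) + 2) * ((n : ℚ) + 1) / 2 * (c ^ 2 - ((n : ℚ) + 1) * c) + ((n : ℚ) + 2) * ((n : ℚ) + 1) * n * (3 * n + 5) / 24 := by
  have hstep : ∀ n : ℕ, (descPochhammer ℚ (n + 2)).comp (Polynomial.X + Polynomial.C c) =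
      (descPochhammer ℚ (n + 1)).comp (Polynomial.X + Polynomial.C c) * Polynomial.X
        + Polynomial.C (c - ((n : ℚ) + 1)) * (descPochhammer ℚ (n + 1)).comp (Polynomial.X + Polynomial.C c) := by
    intro n
    rw [show n + 2 = (n + 1) + 1 by ring, descPochhammer_succ_right, Polynomial.mul_comp, Polynomial.sub_comp, Polynomial.X_comp,
      show ((n + 1 : ℕ) : Polynomial ℚ) = Polynomial.C ((n + 1 : ℕ) : ℚ) by rw [Polynomial.C_eq_natCast], Polynomial.C_comp]
    push_cast
    rw [map_sub, map_add, map_one]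
    ring
  have hmon : ∀ n : ℕ, ((descPochhammer ℚ (n + 1)).comp (Polynomial.X + Polynomial.C c)).coeff (n + 1) = 1 := by
    intro n
    have hm : ((descPochhammer ℚ (n + 1)).comp (Polynomial.X + Polynomial.C c)).Monic := (monic_descPochhammer ℚ _).comp_X_add_C _
    have hd : ((descPochhammer ℚ (n + 1)).comp (Polynomial.X + Polynomial.C c)).natDegree = n + 1 := by
      rw [Polynomial.natDegree_comp, descPochhammer_natDegree, Polynomial.natDegree_X_add_C, mul_one]
    have := hm.coeff_natDegree; rwa [hd] at this
  induction n with
  | zero =>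
    have hQ1 : (descPochhammer ℚ (0 + 1)).comp (Polynomial.X + Polynomial.C c) = Polynomial.X + Polynomial.C c := by
      rw [Nat.zero_add, descPochhammer_one, Polynomial.X_comp]
    rw [hstep 0, hQ1]
    refine ⟨?_, ?_⟩
    · rw [Polynomial.coeff_add, Nat.zero_add, show (1 : ℕ) = 0 + 1 from rfl, Polynomial.coeff_mul_X, Polynomial.coeff_C_mul, Polynomial.coeff_add,
        Polynomial.coeff_add, Polynomial.coeff_X_zero, Polynomial.coeff_C_zero, zero_add, Nat.zero_add, Polynomial.coeff_X_one, Polynomial.coeff_C,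
        if_neg one_ne_zero]
      push_cast; ring
    · rw [Polynomial.coeff_add, Polynomial.mul_coeff_zero, Polynomial.coeff_X_zero, mul_zero, zero_add, Polynomial.coeff_C_mul, Polynomial.coeff_add,
        Polynomial.coeff_X_zero, Polynomial.coeff_C_zero, zero_add]
      push_cast; ring
  | succ n ih =>
    rw [show n + 1 + 2 = (n + 1) + 2 by ring, hstep (n + 1)]
    refine ⟨?_, ?_⟩
    · rw [Polynomial.coeff_add, show n + 1 + 1 = (n + 1) + 1 by ring, Polynomial.coeff_mul_X, Polynomial.coeff_C_mul, ih.1, hmon (n + 1)]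
      push_cast; ring
    · rw [Polynomial.coeff_add, Polynomial.coeff_mul_X, Polynomial.coeff_C_mul, ih.1, ih.2]
      push_cast; ring

/-! ### The three third-layer shape sums -/

open Classical in
/-- The THIRD-LAYER TOP SUM `T'_j = Σ_{A valid on 2j letters, breaks A = 2j − 5} #shapeClass_j(2j, A)` (five adjacencies; run types `{6}`, `{5,2}`, `{4,3}`,
`{4,2,2}`; the lane's census `M_j(2j, 2j−5)`: `5040, 355200, 24380160, 1753436160` for `j = 4…7`). [cite: MadrasSlade1993, Definition 1.2.4; lane tool notion] -/
noncomputable def thirdShapeSumTop (j : ℕ) : ℕ :=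
  ∑ A : Fin (2 * j) → Bool, if AdjValid A ∧ breaks A = 2 * j - 5 then (shapeClass j (2 * j) A).card else 0

open Classical in
/-- The THIRD-LAYER MIDDLE SUM `X'_j = Σ_{A valid on 2j − 1 letters, breaks A = 2j − 5} #shapeClass_j(2j−1, A)` (four adjacencies, one axis thrice;
run types `{5}`, `{4,2}`; census `M_j(2j−1, 2j−5)`: `2256, 137920, 8359680, 546739200` for `j = 4…7`). [cite: MadrasSlade1993, Definition 1.2.4; lane tool notion] -/
noncomputable def thirdShapeSumMid (j : ℕ) : ℕ :=
  ∑ A : Fin (2 * j - 1) → Bool, if AdjValid A ∧ breaks A = 2 * j - 5 then (shapeClass j (2 * j - 1) A).card else 0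

open Classical in
/-- The THIRD-LAYER LOWER SUM `W'_j = Σ_{A valid on 2j − 2 letters, breaks A = 2j − 5} #shapeClass_j(2j−2, A)` (one run of four on `2j − 2` letters;
census `M_j(2j−2, 2j−5)`: `192, 10560, 582400` for `j = 4, 5, 6`). [cite: MadrasSlade1993, Definition 1.2.4; lane tool notion] -/
noncomputable def thirdShapeSumLow (j : ℕ) : ℕ :=
  ∑ A : Fin (2 * j - 2) → Bool, if AdjValid A ∧ breaks A = 2 * j - 5 then (shapeClass j (2 * j - 2) A).card else 0

/-! ### Which terms of `symbolPoly j` reach `X^{2j−5}` -/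

open Classical Polynomial in
/-- Off the six corners `(u, breaks) ∈ {(2j,2j−3), (2j,2j−4), (2j−1,2j−4), (2j,2j−5), (2j−1,2j−5), (2j−2,2j−5)}` a term of `symbolPoly j` has no `X^{2j−5}`
coefficient (`j ≥ 3`): a non-empty class needs `breaks + 3 ≤ u ≤ 2j`. [cite: MadrasSlade1993, Definition 1.2.4; lane plumbing] -/
theorem coeff_symbolPoly_term_sub_five_eq_zero (j u : ℕ) (A : Fin u → Bool) (hj : 3 ≤ j)
    (h : ¬ ((u = 2 * j ∧ breaks A = 2 * j - 3) ∨ (u = 2 * j ∧ breaks A = 2 * j - 4) ∨ (u = 2 * j - 1 ∧ breaks A = 2 * j - 4) ∨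
      (u = 2 * j ∧ breaks A = 2 * j - 5) ∨ (u = 2 * j - 1 ∧ breaks A = 2 * j - 5) ∨ (u = 2 * j - 2 ∧ breaks A = 2 * j - 5))) :
    (Polynomial.C (((shapeClass j u A).card : ℚ) * (1 / 2) ^ u / ((breaks A).factorial : ℚ)) *
        (descPochhammer ℚ (breaks A)).comp (Polynomial.X + Polynomial.C ((1 : ℚ) - u))).coeff (2 * j - 5) = 0 := by
  by_cases hne : (shapeClass j u A).card = 0
  · rw [symbolPoly_term_eq_zero_of_card_eq_zero j u A hne, Polynomial.coeff_zero]
  · obtain ⟨κ, hκ⟩ := Finset.card_pos.1 (Nat.pos_of_ne_zero hne)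
    have h3 := breaks_add_three_le_of_mem_shapeClass hκ
    have hu2 : u ≤ 2 * j := by
      by_contra h'
      rw [shapeClass_eq_empty j u A (by omega)] at hκ
      simp at hκ
    by_cases hb : breaks A < 2 * j - 5
    · exact coeff_symbolPoly_term_eq_zero_of_breaks_lt j u A hb
    · exfalso; apply h; omega

open Classical Polynomial in
/-- The top corner two below its top: for `breaks A = 2j − 3` on `u = 2j` letters (`j ≥ 3`), `[X^{2j−5}]` of the term is `#class·2^{−2j}/(2j−3)!·e₂(j)`,
`e₂(j) = (2j−3)(2j−4)/2·((1−2j)² − (2j−4)(1−2j)) + (2j−3)(2j−4)(2j−5)(3(2j−5)+5)/24`. [cite: MadrasSlade1993, Definition 1.2.4; lane plumbing] -/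
theorem coeff_symbolPoly_term_top_sub_five (j : ℕ) (hj : 3 ≤ j) (A : Fin (2 * j) → Bool) (hb : breaks A = 2 * j - 3) :
    (Polynomial.C (((shapeClass j (2 * j) A).card : ℚ) * (1 / 2) ^ (2 * j) / ((breaks A).factorial : ℚ)) *
        (descPochhammer ℚ (breaks A)).comp (Polynomial.X + Polynomial.C ((1 : ℚ) - (2 * j : ℕ)))).coeff (2 * j - 5)
      = ((shapeClass j (2 * j) A).card : ℚ) * (1 / 2) ^ (2 * j) / ((2 * j - 3).factorial : ℚ) *
        ((2 * (j : ℚ) - 3) * (2 * j - 4) / 2 * ((1 - 2 * (j : ℚ)) ^ 2 - (2 * j - 4) * (1 - 2 * j))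
          + (2 * (j : ℚ) - 3) * (2 * j - 4) * (2 * j - 5) * (3 * (2 * j - 5) + 5) / 24) := by
  rw [Polynomial.coeff_C_mul, hb]
  obtain ⟨k, rfl⟩ : ∃ k, j = k + 3 := ⟨j - 3, by omega⟩
  have e1 : 2 * (k + 3) - 3 = (2 * k + 1) + 2 := by omega
  have e2 : 2 * (k + 3) - 5 = 2 * k + 1 := by omega
  rw [e1, e2, (coeff_descPochhammer_comp_X_add_C_pair (2 * k + 1) _).2]
  push_cast
  ring

open Classical Polynomial in
/-- A corner with `breaks A = 2j − 4` (`j ≥ 3`) one below its top: `[X^{2j−5}]` of the term is `#class·2^{−u}/(2j−4)!·((2j−4)(1−u) − (2j−4)(2j−5)/2)`.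
[cite: MadrasSlade1993, Definition 1.2.4; lane plumbing] -/
theorem coeff_symbolPoly_term_second_sub_five (j u : ℕ) (hj : 3 ≤ j) (A : Fin u → Bool) (hb : breaks A = 2 * j - 4) :
    (Polynomial.C (((shapeClass j u A).card : ℚ) * (1 / 2) ^ u / ((breaks A).factorial : ℚ)) *
        (descPochhammer ℚ (breaks A)).comp (Polynomial.X + Polynomial.C ((1 : ℚ) - u))).coeff (2 * j - 5)
      = ((shapeClass j u A).card : ℚ) * (1 / 2) ^ u / ((2 * j - 4).factorial : ℚ) * ((2 * (j : ℚ) - 4) * (1 - u) - (2 * (j : ℚ) - 4) * (2 * j - 5) / 2) := by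
  rw [Polynomial.coeff_C_mul, hb]
  obtain ⟨k, rfl⟩ : ∃ k, j = k + 3 := ⟨j - 3, by omega⟩
  have e1 : 2 * (k + 3) - 4 = (2 * k) + 2 := by omega
  have e2 : 2 * (k + 3) - 5 = 2 * k + 1 := by omega
  rw [e1, e2, (coeff_descPochhammer_comp_X_add_C_pair (2 * k) _).1]
  push_cast
  ring

open Classical Polynomial in
/-- A corner at its top: for `breaks A = b` the term's `X^b` coefficient is `#class·2^{−u}/b!`. [cite: MadrasSlade1993, Definition 1.2.4; lane plumbing] -/
theorem coeff_symbolPoly_term_breaks (j u : ℕ) (A : Fin u → Bool) (b : ℕ) (hb : breaks A = b) :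
    (Polynomial.C (((shapeClass j u A).card : ℚ) * (1 / 2) ^ u / ((breaks A).factorial : ℚ)) *
        (descPochhammer ℚ (breaks A)).comp (Polynomial.X + Polynomial.C ((1 : ℚ) - u))).coeff b
      = ((shapeClass j u A).card : ℚ) * (1 / 2) ^ u / (b.factorial : ℚ) := by
  rw [Polynomial.coeff_C_mul, hb]
  set p : Polynomial ℚ := (descPochhammer ℚ b).comp (Polynomial.X + Polynomial.C ((1 : ℚ) - u)) with hp
  have hmon : p.Monic := (monic_descPochhammer ℚ _).comp_X_add_C _
  have hdeg : p.natDegree = b := by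
    rw [hp, Polynomial.natDegree_comp, descPochhammer_natDegree, Polynomial.natDegree_X_add_C, mul_one]
  have hc : p.coeff b = 1 := by
    have := hmon.coeff_natDegree; rwa [hdeg] at this
  rw [hc, mul_one]

/-! ### ★★★ The third coefficient of `R_j` -/

open Classical Polynomial in
/-- ★★★ THE THIRD COEFFICIENT OF THE SYMBOL POLYNOMIAL FROM SIX CORNER SUMS: for every `j ≥ 3`,
`[X^{2j−5}] R_j = S_j·2^{−2j}/(2j−3)!·e₂(j) + U'_j·2^{−2j}/(2j−4)!·s_U(j) + V'_j·2^{−(2j−1)}/(2j−4)!·s_V(j) + T'_j·2^{−2j}/(2j−5)! + X'_j·2^{−(2j−1)}/(2j−5)! +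
W'_j·2^{−(2j−2)}/(2j−5)!` (`S_j = topShapeSum j`, `U'_j, V'_j` the second-layer sums, `T'_j, X'_j, W'_j` the third-layer sums). With the closed forms
(λ: `S_j = (2j−3)(2j−5)‼2^{2j−2}`; §15: `U'_j`, `V'_j`; §16: `T_j, X_j, W_j`) this is `(8j⁴ − 13j³ − 8j² + 28j − 48)/(9·2^j·(j−2)!)` — `29/8, 4, 121/64, 77/144` for
`j = 3…6` (the tree's `R₃…R₆`). [cite: MadrasSlade1993, §1.1 eq. (1.1.8) p. 5; Definition 1.2.4] [cite: ClisbyLiangSlade2007, §3.3 eqs. (29)/(31); lane theorem] -/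
theorem coeff_symbolPoly_two_mul_sub_five (j : ℕ) (hj : 3 ≤ j) :
    (symbolPoly j).coeff (2 * j - 5) =
      (topShapeSum j : ℚ) * (1 / 2) ^ (2 * j) / ((2 * j - 3).factorial : ℚ) *
          ((2 * (j : ℚ) - 3) * (2 * j - 4) / 2 * ((1 - 2 * (j : ℚ)) ^ 2 - (2 * j - 4) * (1 - 2 * j))
            + (2 * (j : ℚ) - 3) * (2 * j - 4) * (2 * j - 5) * (3 * (2 * j - 5) + 5) / 24)
      + (secondShapeSumTop j : ℚ) * (1 / 2) ^ (2 * j) / ((2 * j - 4).factorial : ℚ) * ((2 * (j : ℚ) - 4) * (1 - (2 * j : ℕ)) - (2 * (j : ℚ) - 4) * (2 * j - 5) / 2)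
      + (secondShapeSumBelow j : ℚ) * (1 / 2) ^ (2 * j - 1) / ((2 * j - 4).factorial : ℚ) *
          ((2 * (j : ℚ) - 4) * (1 - (2 * j - 1 : ℕ)) - (2 * (j : ℚ) - 4) * (2 * j - 5) / 2)
      + (thirdShapeSumTop j : ℚ) * (1 / 2) ^ (2 * j) / ((2 * j - 5).factorial : ℚ)
      + (thirdShapeSumMid j : ℚ) * (1 / 2) ^ (2 * j - 1) / ((2 * j - 5).factorial : ℚ)
      + (thirdShapeSumLow j : ℚ) * (1 / 2) ^ (2 * j - 2) / ((2 * j - 5).factorial : ℚ) := by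
  unfold symbolPoly topShapeSum secondShapeSumTop secondShapeSumBelow thirdShapeSumTop thirdShapeSumMid thirdShapeSumLow
  have hsplit : Finset.range (2 * j + 1) = Finset.range (2 * j - 2) ∪ {2 * j - 2, 2 * j - 1, 2 * j} := by
    ext u; simp only [Finset.mem_range, Finset.mem_union, Finset.mem_insert, Finset.mem_singleton]; omega
  rw [Polynomial.finsetSum_coeff, hsplit, Finset.sum_union (by
    rw [Finset.disjoint_left]; intro u hu hu'
    simp only [Finset.mem_range] at hu; simp only [Finset.mem_insert, Finset.mem_singleton] at hu'; omega)]
  rw [Finset.sum_eq_zero (fun u hu => ?_), zero_add, Finset.sum_insert (by simp only [Finset.mem_insert, Finset.mem_singleton]; omega),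
    Finset.sum_insert (by simp only [Finset.mem_singleton]; omega), Finset.sum_singleton]
  · -- the three top slices: `u = 2j − 2` (corner W), `u = 2j − 1` (corners V, X), `u = 2j` (corners S, U, T)
    have hlow : (∑ A : Fin (2 * j - 2) → Bool, if AdjValid A then Polynomial.C (((shapeClass j (2 * j - 2) A).card : ℚ) * (1 / 2) ^ (2 * j - 2) /
          ((breaks A).factorial : ℚ)) * (descPochhammer ℚ (breaks A)).comp (Polynomial.X + Polynomial.C ((1 : ℚ) - (2 * j - 2 : ℕ))) else 0).coeff (2 * j - 5)
        = ((∑ A : Fin (2 * j - 2) → Bool, if AdjValid A ∧ breaks A = 2 * j - 5 then (shapeClass j (2 * j - 2) A).card else 0 : ℕ) : ℚ)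
            * (1 / 2) ^ (2 * j - 2) / ((2 * j - 5).factorial : ℚ) := by
      rw [Polynomial.finsetSum_coeff, Nat.cast_sum, Finset.sum_mul, Finset.sum_div]
      refine Finset.sum_congr rfl fun A _ => ?_
      by_cases hv : AdjValid A
      · rw [if_pos hv]
        by_cases hb5 : breaks A = 2 * j - 5
        · rw [if_pos ⟨hv, hb5⟩, ← hb5, coeff_symbolPoly_term_breaks j (2 * j - 2) A _ rfl, hb5]
        · rw [if_neg (fun h => hb5 h.2), coeff_symbolPoly_term_sub_five_eq_zero j (2 * j - 2) A hj (by omega)]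
          push_cast; ring
      · rw [if_neg hv, if_neg (fun h => hv h.1)]
        simp
    have hmid : (∑ A : Fin (2 * j - 1) → Bool, if AdjValid A then Polynomial.C (((shapeClass j (2 * j - 1) A).card : ℚ) * (1 / 2) ^ (2 * j - 1) /
          ((breaks A).factorial : ℚ)) * (descPochhammer ℚ (breaks A)).comp (Polynomial.X + Polynomial.C ((1 : ℚ) - (2 * j - 1 : ℕ))) else 0).coeff (2 * j - 5)
        = ((∑ A : Fin (2 * j - 1) → Bool, if AdjValid A ∧ breaks A = 2 * j - 4 then (shapeClass j (2 * j - 1) A).card else 0 : ℕ) : ℚ)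
              * (1 / 2) ^ (2 * j - 1) / ((2 * j - 4).factorial : ℚ) * ((2 * (j : ℚ) - 4) * (1 - (2 * j - 1 : ℕ)) - (2 * (j : ℚ) - 4) * (2 * j - 5) / 2)
          + ((∑ A : Fin (2 * j - 1) → Bool, if AdjValid A ∧ breaks A = 2 * j - 5 then (shapeClass j (2 * j - 1) A).card else 0 : ℕ) : ℚ)
              * (1 / 2) ^ (2 * j - 1) / ((2 * j - 5).factorial : ℚ) := by
      rw [Polynomial.finsetSum_coeff, Nat.cast_sum, Nat.cast_sum, Finset.sum_mul, Finset.sum_div, Finset.sum_mul, Finset.sum_mul, Finset.sum_div,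
        ← Finset.sum_add_distrib]
      refine Finset.sum_congr rfl fun A _ => ?_
      by_cases hv : AdjValid A
      · rw [if_pos hv]
        by_cases hb4 : breaks A = 2 * j - 4
        · rw [if_pos ⟨hv, hb4⟩, if_neg (fun h => by omega), coeff_symbolPoly_term_second_sub_five j (2 * j - 1) hj A hb4]
          push_cast; ring
        · by_cases hb5 : breaks A = 2 * j - 5
          · rw [if_neg (fun h => hb4 h.2), if_pos ⟨hv, hb5⟩, ← hb5, coeff_symbolPoly_term_breaks j (2 * j - 1) A _ rfl, hb5]
            push_cast; ring
          · rw [if_neg (fun h => hb4 h.2), if_neg (fun h => hb5 h.2), coeff_symbolPoly_term_sub_five_eq_zero j (2 * j - 1) A hj (by omega)]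
            push_cast; ring
      · rw [if_neg hv, if_neg (fun h => hv h.1), if_neg (fun h => hv h.1)]
        simp
    have htop : (∑ A : Fin (2 * j) → Bool, if AdjValid A then Polynomial.C (((shapeClass j (2 * j) A).card : ℚ) * (1 / 2) ^ (2 * j) /
          ((breaks A).factorial : ℚ)) * (descPochhammer ℚ (breaks A)).comp (Polynomial.X + Polynomial.C ((1 : ℚ) - (2 * j : ℕ))) else 0).coeff (2 * j - 5)
        = ((∑ A : Fin (2 * j) → Bool, if AdjValid A ∧ breaks A = 2 * j - 3 then (shapeClass j (2 * j) A).card else 0 : ℕ) : ℚ)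
              * (1 / 2) ^ (2 * j) / ((2 * j - 3).factorial : ℚ) *
              ((2 * (j : ℚ) - 3) * (2 * j - 4) / 2 * ((1 - 2 * (j : ℚ)) ^ 2 - (2 * j - 4) * (1 - 2 * j))
                + (2 * (j : ℚ) - 3) * (2 * j - 4) * (2 * j - 5) * (3 * (2 * j - 5) + 5) / 24)
          + ((∑ A : Fin (2 * j) → Bool, if AdjValid A ∧ breaks A = 2 * j - 4 then (shapeClass j (2 * j) A).card else 0 : ℕ) : ℚ)
              * (1 / 2) ^ (2 * j) / ((2 * j - 4).factorial : ℚ) * ((2 * (j : ℚ) - 4) * (1 - (2 * j : ℕ)) - (2 * (j : ℚ) - 4) * (2 * j - 5) / 2)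
          + ((∑ A : Fin (2 * j) → Bool, if AdjValid A ∧ breaks A = 2 * j - 5 then (shapeClass j (2 * j) A).card else 0 : ℕ) : ℚ)
              * (1 / 2) ^ (2 * j) / ((2 * j - 5).factorial : ℚ) := by
      rw [Polynomial.finsetSum_coeff, Nat.cast_sum, Nat.cast_sum, Nat.cast_sum, Finset.sum_mul, Finset.sum_div, Finset.sum_mul, Finset.sum_mul,
        Finset.sum_div, Finset.sum_mul, Finset.sum_mul, Finset.sum_div, ← Finset.sum_add_distrib, ← Finset.sum_add_distrib]
      refine Finset.sum_congr rfl fun A _ => ?_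
      by_cases hv : AdjValid A
      · rw [if_pos hv]
        by_cases hb3 : breaks A = 2 * j - 3
        · rw [if_pos ⟨hv, hb3⟩, if_neg (fun h => by omega), if_neg (fun h => by omega), coeff_symbolPoly_term_top_sub_five j hj A hb3]
          push_cast; ring
        · by_cases hb4 : breaks A = 2 * j - 4
          · rw [if_neg (fun h => hb3 h.2), if_pos ⟨hv, hb4⟩, if_neg (fun h => by omega), coeff_symbolPoly_term_second_sub_five j (2 * j) hj A hb4]
            push_cast; ring
          · by_cases hb5 : breaks A = 2 * j - 5
            · rw [if_neg (fun h => hb3 h.2), if_neg (fun h => hb4 h.2), if_pos ⟨hv, hb5⟩, ← hb5, coeff_symbolPoly_term_breaks j (2 * j) A _ rfl, hb5]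
              push_cast; ring
            · rw [if_neg (fun h => hb3 h.2), if_neg (fun h => hb4 h.2), if_neg (fun h => hb5 h.2),
                coeff_symbolPoly_term_sub_five_eq_zero j (2 * j) A hj (by omega)]
              push_cast; ring
      · rw [if_neg hv, if_neg (fun h => hv h.1), if_neg (fun h => hv h.1), if_neg (fun h => hv h.1)]
        simp
    rw [hlow, hmid, htop]
    ring
  · -- the slices `u < 2j − 2` do not reach `X^{2j−5}`
    have hu' : u < 2 * j - 2 := Finset.mem_range.1 hu
    rw [Polynomial.finsetSum_coeff]
    refine Finset.sum_eq_zero fun A _ => ?_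
    by_cases hv : AdjValid A
    · rw [if_pos hv]
      exact coeff_symbolPoly_term_sub_five_eq_zero j u A hj (by omega)
    · rw [if_neg hv]; simp

end WordTypes

end Literature.Probability.RandomPlanarGeometry.SAW.Zd
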